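import Summits.ResolutionOfSingularities.ResolutionOfSingularities.Theorems.WeightedInvariantWeightedThesisHypersurfaceDatum
import Summits.ResolutionOfSingularities.ResolutionOfSingularities.Theorems.WeightedInvariantDatumToEmbeddedRegular
import Mathlib.AlgebraicGeometry.FunctionField
import HarnessLib

/-!
# The hypersurface tower — resolved case, maximum of the invariant, induction engine

Support for crux `stmt-ResolutionOfSingularities-0569`
(`Summit.ResolutionOfSingularities.ResolutionOfSingularities.Theses.WeightedInvariant.WeightedThesis`),
line `datum-glued-split`, RESHAPE 7 (lead c7): the datum-side ingredients of the cobordant tower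
(`Theorems/WeightedInvariantDatumToEmbeddedRegular.lean`, crux 0572) re-read for a HYPERSURFACE
resolution datum `D : HypersurfaceResolutionDatum p` (`Theorems/…HypersurfaceDatum.lean`), i.e. with
the axioms `(usc)`, `(ii)`, `(iii)` available only on pairs `(Y, I)` with `I` locally principal and
`I.subscheme` integral:

* `HypersurfaceTower.isIntegral_ker_subscheme` — for a closed immersion `i : X ⟶ Y` of an integral
  `X`, `(ker i).subscheme ≅ X` is integral (the guard of the axioms for the pair `(Y, ker i)`);
* `HypersurfaceTower.isRegular_of_forall_inv_isBot`, `inv_apply_isBot_of_isRegularLocalRing` — axiom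
  `(ii)` on a closed immersion: `inv` of `(Y, ker i)` everywhere minimal ⇒ `X` regular; `𝒪_{X,x}`
  regular ⇒ `inv (i x) = ⊥`;
* `HypersurfaceTower.genericPoint_not_mem_support_centre` — under the guard of `(iii)` the generic point
  of the integral `X` is off the centre (its local ring, the function field, is regular, and the centre
  is the maximum locus) — the hypothesis `hξ` of the datum-free tower lemmas
  (`Theorems/…TowerGenericAmbient.lean`, `…TowerGenericQuotient.lean`);
* `HypersurfaceTower.exists_isMax_inv` — on a non-empty `Y` the invariant attains its maximum;
* `HypersurfaceTower.maxinv_induction` — **the induction engine on hypersurface pairs**: a property of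
  hypersurface pairs that holds in the resolved case and climbs one step of `max inv` holds for every
  hypersurface pair (well-founded induction on `max inv ∈ D.Γ`).
-/

noncomputable section

open CategoryTheory AlgebraicGeometry TopologicalSpace
open Literature.AlgebraicGeometry.Resolution

set_option linter.dupNamespace false -- mandated namespace of this single-conjunct summit

namespace Summit.ResolutionOfSingularities.ResolutionOfSingularities.Theorems.HypersurfaceTower

/-! ## The guard: `(ker i).subscheme` is integral -/

/-- For a closed immersion `i : X ⟶ Y` of an integral scheme, the image subscheme `V(ker i)` is
integral (`i.toImage : X ⟶ V(ker i)` is an isomorphism). [folklore] -/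
theorem isIntegral_ker_subscheme : ∀ {X Y : AlgebraicGeometry.Scheme.{0}} (i : X ⟶ Y) [AlgebraicGeometry.IsClosedImmersion i] [AlgebraicGeometry.IsIntegral X], AlgebraicGeometry.IsIntegral i.ker.subscheme :=
  fun i _ _ => IsIntegral.of_isIso i.toImage

/-! ## Axiom `(ii)` on a closed immersion -/

section Datum

variable {p : ℕ} (D : HypersurfaceResolutionDatum p) {k : Type} [Field k] [CharP k p] [PerfectField k]
  {Y X : Scheme.{0}} (f : Y ⟶ Spec (.of k)) [Smooth f] [IsSeparated f] [QuasiCompact f]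
  (i : X ⟶ Y) [IsClosedImmersion i]

/-- **Axiom `(ii)` read on a closed immersion, resolved direction** (hypersurface datum): for
`i : X ⟶ Y` a closed immersion with locally principal kernel and integral image, if the invariant of
`(Y, ker i)` is everywhere minimal then `X` is regular. [folklore] -/
theorem isRegular_of_forall_inv_isBot (hX : IsLocallyPrincipal i.ker) (hXi : IsIntegral i.ker.subscheme)
    (h : ∀ y : Y, IsBot (D.inv f i.ker y)) : Scheme.IsRegular X := by
  rw [isRegular_iff_isRegular_image i]
  intro x
  exact (D.isBot_inv_iff f i.ker hX hXi (i.ker.subschemeι x)).mp (h _) x rfl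

/-- **Axiom `(ii)` at a regular point** (hypersurface datum): if `𝒪_{X,x}` is a regular local ring
then the invariant of `(Y, ker i)` is minimal at `i x`. [folklore] -/
theorem inv_apply_isBot_of_isRegularLocalRing (hX : IsLocallyPrincipal i.ker)
    (hXi : IsIntegral i.ker.subscheme) (x : X) (h : IsRegularLocalRing (X.presheaf.stalk x)) :
    IsBot (D.inv f i.ker (i x)) := by
  rw [D.isBot_inv_iff f i.ker hX hXi (i x)]
  intro x' hx'
  obtain ⟨x₀, rfl⟩ := i.toImage.surjective x'
  rw [toImage_apply_eq_iff] at hx'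
  have hx₀ : x₀ = x := i.isClosedEmbedding.injective hx'
  subst hx₀
  exact (isRegularLocalRing_stalk_image_iff i x₀).mpr h

/-- **The generic point of the integral `X` is off the centre** (hypersurface datum, guard of `(iii)`
on): its local ring is the function field, which is regular, so `inv` is minimal there (`(ii)`), while
the support of the centre is the maximum locus of `inv` (`(iii)`), whose points have non-minimal
value. This is the hypothesis `hξ` of the datum-free tower lemmas. [folklore] -/
theorem genericPoint_not_mem_support_centre [IsIntegral X] (hX : IsLocallyPrincipal i.ker)
    (hXi : IsIntegral i.ker.subscheme) (hguard : ∃ y : Y, ¬ IsBot (D.inv f i.ker y)) :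
    i (genericPoint X) ∉ (D.centre f i.ker).support := by
  have hbot : IsBot (D.inv f i.ker (i (genericPoint X))) := by
    refine inv_apply_isBot_of_isRegularLocalRing D f i hX hXi (genericPoint X) ?_
    change IsRegularLocalRing X.functionField
    infer_instance
  intro hmem
  rw [D.support_centre f i.ker hX hXi hguard] at hmem
  obtain ⟨y₀, hy₀⟩ := hguard
  exact hy₀ fun γ => (hmem y₀).trans (hbot γ)

end Datum

/-! ## The invariant attains its maximum -/

section Max

variable {p : ℕ} (D : HypersurfaceResolutionDatum p) {k : Type} [Field k] [CharP k p] [PerfectField k]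
  {Y : Scheme.{0}} (f : Y ⟶ Spec (.of k)) [Smooth f] [IsSeparated f] [QuasiCompact f]

/-- On a hypersurface pair the invariant takes finitely many values (`Y` smooth quasi-compact over a
field is a Noetherian scheme and `inv` is upper semicontinuous into a well-order). [folklore] -/
theorem finite_range_inv (I : Y.IdealSheafData) (hI : IsLocallyPrincipal I) (hIi : IsIntegral I.subscheme) :
    (Set.range (D.inv f I)).Finite := by
  haveI : IsNoetherian Y := isNoetherian_of_smooth_quasiCompact f
  exact Literature.AlgGeom.finite_range_of_isClosed_superlevel (D.inv f I)
    (D.isClosed_superlevel f I hI hIi)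

/-- On a non-empty `Y` the invariant of a hypersurface pair attains its maximum. [folklore] -/
theorem exists_isMax_inv [Nonempty Y] (I : Y.IdealSheafData) (hI : IsLocallyPrincipal I)
    (hIi : IsIntegral I.subscheme) :
    ∃ y : Y, ∀ y' : Y, D.inv f I y' ≤ D.inv f I y := by
  haveI : IsNoetherian Y := isNoetherian_of_smooth_quasiCompact f
  exact Literature.AlgGeom.exists_max_of_isClosed_superlevel (D.inv f I)
    (D.isClosed_superlevel f I hI hIi)

end Max

/-! ## Well-founded induction on the maximum of the invariant, over hypersurface pairs -/

section Induction

variable {p : ℕ} (D : HypersurfaceResolutionDatum p) {k : Type} [Field k] [CharP k p] [PerfectField k]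

/-- **The induction engine on hypersurface pairs.** Let `Q` be a property of pairs
`(f : Y → Spec k, I)` (`Y` smooth separated quasi-compact over the perfect field `k`, `I` a locally
principal ideal sheaf on `Y` with integral subscheme). Suppose `Q` holds whenever the invariant of the
hypersurface datum `D` is everywhere minimal, and that `Q` holds for a hypersurface pair `(f, I)` with a
point `y₀` of maximal, non-minimal invariant as soon as it holds for every hypersurface pair whose
invariant is everywhere strictly below `inv y₀`. Then `Q` holds for every hypersurface pair:
well-founded induction on `max inv ∈ D.Γ` (`exists_isMax_inv`). Shape of
Abramovich–Temkin–Włodarczyk 2024, proof of Thm. 1.1.1 ("by induction on `maxinv`").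
[cite: AbramovichTemkinWlodarczyk2024, Thm. 1.1.1 (proof)] -/
theorem maxinv_induction
    (Q : ∀ (Y : Scheme.{0}), (Y ⟶ Spec (.of k)) → Y.IdealSheafData → Prop)
    (base : ∀ (Y : Scheme.{0}) (f : Y ⟶ Spec (.of k)) [Smooth f] [IsSeparated f] [QuasiCompact f]
      (I : Y.IdealSheafData), IsLocallyPrincipal I → IsIntegral I.subscheme →
      (∀ y : Y, IsBot (D.inv f I y)) → Q Y f I)
    (step : ∀ (Y : Scheme.{0}) (f : Y ⟶ Spec (.of k)) [Smooth f] [IsSeparated f] [QuasiCompact f]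
      (I : Y.IdealSheafData) (y₀ : Y), IsLocallyPrincipal I → IsIntegral I.subscheme →
      ¬ IsBot (D.inv f I y₀) → (∀ y : Y, D.inv f I y ≤ D.inv f I y₀) →
      (∀ (Y₁ : Scheme.{0}) (f₁ : Y₁ ⟶ Spec (.of k)) [Smooth f₁] [IsSeparated f₁] [QuasiCompact f₁]
        (I₁ : Y₁.IdealSheafData), IsLocallyPrincipal I₁ → IsIntegral I₁.subscheme →
        (∀ y₁ : Y₁, D.inv f₁ I₁ y₁ < D.inv f I y₀) → Q Y₁ f₁ I₁) →
      Q Y f I)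
    (Y : Scheme.{0}) (f : Y ⟶ Spec (.of k)) [Smooth f] [IsSeparated f] [QuasiCompact f]
    (I : Y.IdealSheafData) (hI : IsLocallyPrincipal I) (hIi : IsIntegral I.subscheme) : Q Y f I := by
  -- the statement bounded by `γ`, proved by well-founded induction on `γ ∈ D.Γ`
  have key : ∀ γ : D.Γ, ∀ (Y : Scheme.{0}) (f : Y ⟶ Spec (.of k)) [Smooth f] [IsSeparated f]
      [QuasiCompact f] (I : Y.IdealSheafData), IsLocallyPrincipal I → IsIntegral I.subscheme →
      (∀ y : Y, D.inv f I y ≤ γ) → Q Y f I := by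
    intro γ
    induction γ using WellFoundedLT.induction with
    | ind γ ih =>
      intro Y f _ _ _ I hI hIi hγ
      by_cases hbot : ∀ y : Y, IsBot (D.inv f I y)
      · exact base Y f I hI hIi hbot
      · push Not at hbot
        obtain ⟨y₁, hy₁⟩ := hbot
        haveI : Nonempty Y := ⟨y₁⟩
        obtain ⟨y₀, hy₀⟩ := exists_isMax_inv D f I hI hIi
        refine step Y f I y₀ hI hIi (fun hb => hy₁ fun γ' => (hy₀ y₁).trans (hb γ')) hy₀ ?_
        intro Y₁ f₁ _ _ _ I₁ hI₁ hI₁i hlt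
        by_cases hbot₁ : ∀ y : Y₁, IsBot (D.inv f₁ I₁ y)
        · exact base Y₁ f₁ I₁ hI₁ hI₁i hbot₁
        · push Not at hbot₁
          obtain ⟨z₁, _⟩ := hbot₁
          haveI : Nonempty Y₁ := ⟨z₁⟩
          obtain ⟨z₀, hz₀⟩ := exists_isMax_inv D f₁ I₁ hI₁ hI₁i
          exact ih (D.inv f₁ I₁ z₀) ((hlt z₀).trans_le (hy₀ y₀ |>.trans (hγ y₀))) Y₁ f₁ I₁ hI₁ hI₁i
            hz₀
  by_cases hbot : ∀ y : Y, IsBot (D.inv f I y)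
  · exact base Y f I hI hIi hbot
  · push Not at hbot
    obtain ⟨y₁, _⟩ := hbot
    haveI : Nonempty Y := ⟨y₁⟩
    obtain ⟨y₀, hy₀⟩ := exists_isMax_inv D f I hI hIi
    exact key (D.inv f I y₀) Y f I hI hIi hy₀

end Induction

end Summit.ResolutionOfSingularities.ResolutionOfSingularities.Theorems.HypersurfaceTower

end
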